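import Summits.RiemannHypothesis.RiemannHypothesis.Theses.LittlewoodRadar
import Literature.NumberTheory.LFunctions.ZetaArgBacklundExplicit
import Literature.NumberTheory.DiophantineGeometry.NamedHypothesesProofs
import HarnessLib

/-!
# `¬ PintzLocalisation` — the original crux of route `LittlewoodRadar` (item stmt-RiemannHypothesis-24249) is misstated

class: misstated · repaired: `PintzLocalisationPos` (item stmt-RiemannHypothesis-23714, the same
statement with the guard `0 < Y`).

`PintzLocalisation` quantifies over ALL real `Y` subject only to `10^4 (1 + log(|γ|+5)) ≤ Real.log Y`.
Mathlib's `Real.log` is even (`Real.log_neg_eq_log`), so `Y := -exp L` satisfies the hypothesis, while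
for a negative base `Y ^ r = exp (log Y · r) · cos (r π)` (`Real.rpow_def_of_neg`). Hence, for a zero
`ρ = β + iγ` whose exponent `r = 10^4 log(|γ|+5)` has `cos (r π) ≤ -1/2`, the window `[Y, Y ^ r]` is
empty (`Y ^ r ≤ -exp(L r)/2 < -exp L = Y`) and the asserted `x` cannot exist.

Such a zero exists unconditionally: with `q₁ = 13.81547`, `q₂ = 13.81553` (so that
`10^4 q₁ = 138154 + 0.7`, `10^4 q₂ = 138154 + 1.3`) the explicit Backlund–Trudgian count
`abs_zetaZeroCount_sub_main_le_explicit` (`|N(T) − (T/2π) log(T/2πe)| ≤ 0.3083 log T + 4.128`, in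
the tree) forces a zero ordinate in `(e^{q₁} − 5, e^{q₂} − 5]` (a window of length `≥ 55` near
`10^6`, where `N` grows by `≥ 78` while the two error terms total `< 17`); for it
`r ∈ (138154.7, 138155.3]`, so `cos (r π) = cos ((r − 138154) π) ≤ cos (2π/3) = -1/2`.

Main result: `not_pintzLocalisation : ¬ PintzLocalisation`. Negative knowledge only (a typing
artefact); the repaired crux `PintzLocalisationPos` is untouched by this witness.
Nothing here bears on the truth of RH.
-/

set_option linter.dupNamespace false

noncomputable section

namespace Summit.RiemannHypothesis.RiemannHypothesis.Theorems.LittlewoodRadar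

open Real
open Summit.RiemannHypothesis.RiemannHypothesis.Theses.LittlewoodRadar
open Literature.NumberTheory.LFunctions

/-! ## A zero of `ζ` with ordinate in a prescribed window near `10^6` -/

/-! Window exponents: `(13.81547 : ℝ) = 13.81547 = (138154 + 0.7)/10^4`, `(13.81553 : ℝ) = 13.81553 = (138154 + 1.3)/10^4`
(written as literals below). -/

/-- `e ≥ 2.71828`. [folklore] -/
lemma exp_one_ge : (2.71828 : ℝ) ≤ Real.exp 1 := by
  have := Real.exp_one_gt_d9; linarith

/-- `e ≤ 2.7182818286`. [folklore] -/
lemma exp_one_le : Real.exp 1 ≤ 2.7182818286 := by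
  have := Real.exp_one_lt_d9; linarith

/-- `exp (1/10) ≥ 1.1`. [folklore] -/
lemma exp_tenth_ge : (1.1 : ℝ) ≤ Real.exp (1 / 10) := by
  have := Real.add_one_le_exp (1 / 10 : ℝ); linarith

/-- `exp (13.81547 : ℝ) ≥ 920000` (from `e^13 ≥ 2.71828^13` and `e^{0.8} ≥ 1.1^8`). [folklore] -/
lemma exp_q₁_ge : (920000 : ℝ) ≤ Real.exp (13.81547 : ℝ) := by
  have h13 : (2.71828 : ℝ) ^ 13 ≤ Real.exp 13 := by
    have := pow_le_pow_left₀ (by norm_num) exp_one_ge 13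
    rw [Real.exp_one_pow 13] at this
    exact_mod_cast this
  have h8 : (1.1 : ℝ) ^ 8 ≤ Real.exp (8 / 10) := by
    have := pow_le_pow_left₀ (by norm_num) exp_tenth_ge 8
    rw [← Real.exp_nat_mul] at this
    norm_num at this ⊢
    exact this
  have hsum : Real.exp 13 * Real.exp (8 / 10) ≤ Real.exp (13.81547 : ℝ) := by
    rw [← Real.exp_add]; exact Real.exp_le_exp.2 (by norm_num)
  have hprod : (2.71828 : ℝ) ^ 13 * (1.1 : ℝ) ^ 8 ≤ Real.exp 13 * Real.exp (8 / 10) :=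
    mul_le_mul h13 h8 (by positivity) (Real.exp_pos _).le
  have hnum : (920000 : ℝ) ≤ (2.71828 : ℝ) ^ 13 * (1.1 : ℝ) ^ 8 := by norm_num
  linarith

/-- `exp (13.81553 : ℝ) ≤ exp 14`. [folklore] -/
lemma exp_q₂_le : Real.exp (13.81553 : ℝ) ≤ Real.exp 14 := Real.exp_le_exp.2 (by norm_num)

/-- The window has length `≥ 55`: `exp (13.81553 : ℝ) − exp (13.81547 : ℝ) ≥ exp (13.81547 : ℝ) · ((13.81553 : ℝ) − (13.81547 : ℝ)) ≥ 920000 · 6·10⁻⁵`. [folklore] -/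
lemma window_length : (55 : ℝ) ≤ Real.exp (13.81553 : ℝ) - Real.exp (13.81547 : ℝ) := by
  have hq : (13.81553 : ℝ) - (13.81547 : ℝ) = 6 / 100000 := by norm_num
  have h1 : Real.exp (13.81553 : ℝ) = Real.exp (13.81547 : ℝ) * Real.exp ((13.81553 : ℝ) - (13.81547 : ℝ)) := by
    rw [← Real.exp_add]; congr 1; ring
  have h2 : 1 + ((13.81553 : ℝ) - (13.81547 : ℝ)) ≤ Real.exp ((13.81553 : ℝ) - (13.81547 : ℝ)) := by
    have := Real.add_one_le_exp ((13.81553 : ℝ) - (13.81547 : ℝ)); linarith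
  have h3 : Real.exp (13.81547 : ℝ) * (1 + ((13.81553 : ℝ) - (13.81547 : ℝ))) ≤ Real.exp (13.81553 : ℝ) := by
    rw [h1]; exact mul_le_mul_of_nonneg_left h2 (Real.exp_pos _).le
  have h4 := exp_q₁_ge
  rw [hq] at h3
  nlinarith

/-- `2π ≤ 6.2832`. [folklore] -/
lemma two_pi_le : 2 * Real.pi ≤ 6.2832 := by linarith [Real.pi_lt_d6]

/-- There is a zero of `ζ` with ordinate in `(e^{(13.81547 : ℝ)} − 5, e^{(13.81553 : ℝ)} − 5]`, by the explicit Backlund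
count `abs_zetaZeroCount_sub_main_le_explicit`. [folklore] -/
theorem exists_zero_in_window :
    ∃ ρ : ℂ, riemannZeta ρ = 0 ∧ Real.exp (13.81547 : ℝ) - 5 < ρ.im ∧ ρ.im ≤ Real.exp (13.81553 : ℝ) - 5 := by
  by_contra hno
  push Not at hno
  set T₁ : ℝ := Real.exp (13.81547 : ℝ) - 5 with hT₁
  set T₂ : ℝ := Real.exp (13.81553 : ℝ) - 5 with hT₂
  have hq1 := exp_q₁_ge
  have hlen := window_length
  have hT₁30 : 30 ≤ T₁ := by rw [hT₁]; linarith
  have hT₁₂ : T₁ ≤ T₂ := by rw [hT₁, hT₂]; linarith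
  have hT₂30 : 30 ≤ T₂ := hT₁30.trans hT₁₂
  have hT₁pos : 0 < T₁ := by linarith
  have hT₂pos : 0 < T₂ := by linarith
  -- no ordinate in (T₁, T₂] ⇒ N(T₂) = N(T₁)
  have hN : zetaZeroCount T₂ = zetaZeroCount T₁ :=
    zetaZeroCount_eq_of_no_ordinate hT₁₂ fun ρ hρ h => absurd h.2 (not_le.2 (hno ρ hρ h.1))
  -- Backlund at both ends
  have hB₁ := abs_zetaZeroCount_sub_main_le_explicit hT₁30
  have hB₂ := abs_zetaZeroCount_sub_main_le_explicit hT₂30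
  rw [hN] at hB₂
  have hB₁' := (abs_le.1 hB₁).2
  have hB₂' := (abs_le.1 hB₂).1
  -- log bounds
  have hlogT₁ : Real.log T₁ ≤ 14 := by
    have : T₁ ≤ Real.exp 14 := by
      rw [hT₁]; linarith [exp_q₂_le, Real.exp_pos (13.81547 : ℝ)]
    have := Real.log_le_log hT₁pos this
    rwa [Real.log_exp] at this
  have hlogT₂ : Real.log T₂ ≤ 14 := by
    have : T₂ ≤ Real.exp 14 := by rw [hT₂]; linarith [exp_q₂_le]
    have := Real.log_le_log hT₂pos this
    rwa [Real.log_exp] at this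
  have hc : 0 < 2 * Real.pi * Real.exp 1 := by positivity
  have hlog₂ : 9 ≤ Real.log (T₂ / (2 * Real.pi * Real.exp 1)) := by
    -- T₂ ≥ 2π e · e^9 = 2π e^{10}
    have h10 : 2 * Real.pi * Real.exp 1 * Real.exp 9 ≤ T₂ := by
      have he13 : Real.exp 13 ≤ Real.exp (13.81553 : ℝ) := Real.exp_le_exp.2 (by norm_num)
      have hsplit : Real.exp 13 = Real.exp 1 * Real.exp 9 * Real.exp 3 := by
        rw [← Real.exp_add, ← Real.exp_add]; norm_num
      have he3 : (19 : ℝ) ≤ Real.exp 3 := by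
        have := pow_le_pow_left₀ (by norm_num) exp_one_ge 3
        rw [Real.exp_one_pow 3] at this
        push_cast at this
        norm_num at this ⊢; linarith
      have hpos19 : 0 < Real.exp 1 * Real.exp 9 := by positivity
      rw [hT₂]
      nlinarith [two_pi_le, Real.exp_pos 9, Real.exp_pos 1]
    have : Real.exp 9 ≤ T₂ / (2 * Real.pi * Real.exp 1) := by
      rw [le_div_iff₀ hc]; linarith
    have := Real.log_le_log (Real.exp_pos 9) this
    rwa [Real.log_exp] at this
  -- monotone lower bound for the main term difference
  have hmain : (T₂ - T₁) * Real.log (T₂ / (2 * Real.pi * Real.exp 1)) ≤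
      T₂ * Real.log (T₂ / (2 * Real.pi * Real.exp 1)) - T₁ * Real.log (T₁ / (2 * Real.pi * Real.exp 1)) := by
    have hmono : Real.log (T₁ / (2 * Real.pi * Real.exp 1)) ≤ Real.log (T₂ / (2 * Real.pi * Real.exp 1)) :=
      Real.log_le_log (div_pos hT₁pos hc) (div_le_div_of_nonneg_right hT₁₂ hc.le)
    nlinarith
  have hdiff : 55 ≤ T₂ - T₁ := by rw [hT₁, hT₂]; linarith
  -- assemble: (T₂−T₁)·9/(2π) ≤ E₁ + E₂
  have hπ := two_pi_le
  have hπpos : 0 < 2 * Real.pi := by positivity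
  have key : (T₂ - T₁) * Real.log (T₂ / (2 * Real.pi * Real.exp 1)) / (2 * Real.pi) ≤
      0.3083 * Real.log T₁ + 4.128 + (0.3083 * Real.log T₂ + 4.128) := by
    have e1 : T₂ / (2 * Real.pi) * Real.log (T₂ / (2 * Real.pi * Real.exp 1)) -
        T₁ / (2 * Real.pi) * Real.log (T₁ / (2 * Real.pi * Real.exp 1)) ≤
        0.3083 * Real.log T₁ + 4.128 + (0.3083 * Real.log T₂ + 4.128) := by linarith
    calc (T₂ - T₁) * Real.log (T₂ / (2 * Real.pi * Real.exp 1)) / (2 * Real.pi)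
        ≤ (T₂ * Real.log (T₂ / (2 * Real.pi * Real.exp 1)) -
            T₁ * Real.log (T₁ / (2 * Real.pi * Real.exp 1))) / (2 * Real.pi) :=
          div_le_div_of_nonneg_right hmain hπpos.le
      _ = T₂ / (2 * Real.pi) * Real.log (T₂ / (2 * Real.pi * Real.exp 1)) -
            T₁ / (2 * Real.pi) * Real.log (T₁ / (2 * Real.pi * Real.exp 1)) := by ring
      _ ≤ _ := e1
  have lower : (55 : ℝ) * 9 / 6.2832 ≤
      (T₂ - T₁) * Real.log (T₂ / (2 * Real.pi * Real.exp 1)) / (2 * Real.pi) := by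
    have hnum : (55 : ℝ) * 9 ≤ (T₂ - T₁) * Real.log (T₂ / (2 * Real.pi * Real.exp 1)) := by
      nlinarith
    calc (55 : ℝ) * 9 / 6.2832 ≤ 55 * 9 / (2 * Real.pi) :=
          div_le_div_of_nonneg_left (by norm_num) hπpos hπ
      _ ≤ _ := div_le_div_of_nonneg_right hnum hπpos.le
  have upper : 0.3083 * Real.log T₁ + 4.128 + (0.3083 * Real.log T₂ + 4.128) ≤ (17 : ℝ) := by
    nlinarith
  have : (55 : ℝ) * 9 / 6.2832 ≤ 17 := lower.trans (key.trans upper)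
  norm_num at this

/-! ## The cosine sign on the window -/

/-- For `u ∈ [2/3, 4/3]`, `cos (u π) ≤ -1/2`. [folklore] -/
lemma cos_le_neg_half {u : ℝ} (h1 : 2 / 3 ≤ u) (h2 : u ≤ 4 / 3) : Real.cos (u * Real.pi) ≤ -1 / 2 := by
  have hval : Real.cos (2 / 3 * Real.pi) = -1 / 2 := by
    rw [show 2 / 3 * Real.pi = Real.pi - Real.pi / 3 by ring, Real.cos_pi_sub, Real.cos_pi_div_three]
    norm_num
  rcases le_or_gt u 1 with hu | hu
  · -- u π ∈ [2π/3, π]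
    rw [← hval]
    exact Real.cos_le_cos_of_nonneg_of_le_pi (by positivity) (by nlinarith [Real.pi_pos])
      (by nlinarith [Real.pi_pos])
  · -- u π ∈ (π, 4π/3]: cos (u π) = cos (2π − u π), 2π − uπ ∈ [2π/3, π)
    rw [← Real.cos_two_pi_sub, ← hval]
    exact Real.cos_le_cos_of_nonneg_of_le_pi (by positivity) (by nlinarith [Real.pi_pos])
      (by nlinarith [Real.pi_pos])

/-- On the window, the Pintz exponent `r = 10^4 log(|γ|+5)` has `cos (r π) ≤ -1/2`. [folklore] -/
lemma cos_exponent_le {γ : ℝ} (h1 : Real.exp (13.81547 : ℝ) - 5 < γ) (h2 : γ ≤ Real.exp (13.81553 : ℝ) - 5) :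
    Real.cos (10 ^ 4 * Real.log (|γ| + 5) * Real.pi) ≤ -1 / 2 := by
  have hγpos : 0 < γ := by linarith [exp_q₁_ge]
  rw [abs_of_pos hγpos]
  have hl1 : (13.81547 : ℝ) < Real.log (γ + 5) := by
    have := Real.log_lt_log (Real.exp_pos (13.81547 : ℝ)) (show Real.exp (13.81547 : ℝ) < γ + 5 by linarith)
    rwa [Real.log_exp] at this
  have hl2 : Real.log (γ + 5) ≤ (13.81553 : ℝ) := by
    have := Real.log_le_log (by linarith) (show γ + 5 ≤ Real.exp (13.81553 : ℝ) by linarith)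
    rwa [Real.log_exp] at this
  -- r π = (r − 138154) π + 69077 · 2π
  have hper : Real.cos (10 ^ 4 * Real.log (γ + 5) * Real.pi) =
      Real.cos ((10 ^ 4 * Real.log (γ + 5) - 138154) * Real.pi) := by
    rw [show 10 ^ 4 * Real.log (γ + 5) * Real.pi =
        (10 ^ 4 * Real.log (γ + 5) - 138154) * Real.pi + (69077 : ℤ) * (2 * Real.pi) by push_cast; ring]
    exact Real.cos_add_int_mul_two_pi _ _
  rw [hper]
  apply cos_le_neg_half
  · norm_num at hl1; linarith
  · norm_num at hl2; linarith

/-! ## The refutation -/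

/-- **`PintzLocalisation` is false as typed** (item stmt-RiemannHypothesis-24249; class: misstated;
repaired: `PintzLocalisationPos`, item 23714). Witness: the zero of `exists_zero_in_window` and
`Y := -exp (10^4 (1 + log(|γ|+5)))`, for which `Real.log Y` is large but `Y ^ r < Y`. [folklore] -/
theorem not_pintzLocalisation : ¬ PintzLocalisation := by
  intro hP
  obtain ⟨ρ, hζ, hγ1, hγ2⟩ := exists_zero_in_window
  have hγpos : 0 < ρ.im := by linarith [exp_q₁_ge]
  have hre0 : 0 < ρ.re :=
    Literature.NumberTheory.DiophantineGeometry.re_pos_of_riemannZeta_eq_zero hζ hγpos.ne'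
  have hre1 : ρ.re < 1 := by
    by_contra h; rw [not_lt] at h
    exact riemannZeta_ne_zero_of_one_le_re h hζ
  set r : ℝ := 10 ^ 4 * Real.log (|ρ.im| + 5) with hr
  set L : ℝ := 10 ^ 4 * (1 + Real.log (|ρ.im| + 5)) with hL
  have hlog5 : (13.81547 : ℝ) < Real.log (|ρ.im| + 5) := by
    rw [abs_of_pos hγpos]
    have := Real.log_lt_log (Real.exp_pos (13.81547 : ℝ)) (show Real.exp (13.81547 : ℝ) < ρ.im + 5 by linarith)
    rwa [Real.log_exp] at this
  have hq₁ : (13 : ℝ) < (13.81547 : ℝ) := by norm_num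
  have hr2 : 2 ≤ r := by rw [hr]; nlinarith
  have hL0 : 1 ≤ L := by rw [hL]; nlinarith
  -- the negative Pintz point
  set Y : ℝ := -Real.exp L with hY
  have hYneg : Y < 0 := by rw [hY]; linarith [Real.exp_pos L]
  have hlogY : Real.log Y = L := by rw [hY, Real.log_neg_eq_log, Real.log_exp]
  obtain ⟨x, hYx, hxY, -⟩ := hP ρ hζ hre0 hre1 Y (by rw [hlogY])
  -- Y ^ r = exp (L r) cos (r π) ≤ -exp(L r)/2 < -exp L = Y
  have hcos : Real.cos (r * Real.pi) ≤ -1 / 2 := by rw [hr]; exact cos_exponent_le hγ1 hγ2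
  have hpow : Y ^ r = Real.exp (L * r) * Real.cos (r * Real.pi) := by
    rw [Real.rpow_def_of_neg hYneg, hlogY]
  have hgrow : 2 * Real.exp L < Real.exp (L * r) := by
    have h2e : (2 : ℝ) < Real.exp 1 := by linarith [exp_one_ge]
    have : Real.exp (L + 1) ≤ Real.exp (L * r) := Real.exp_le_exp.2 (by nlinarith)
    rw [Real.exp_add] at this
    nlinarith [Real.exp_pos L]
  have hlt : Y ^ r < Y := by
    rw [hpow, hY]
    nlinarith [Real.exp_pos (L * r)]
  linarith

end Summit.RiemannHypothesis.RiemannHypothesis.Theorems.LittlewoodRadar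

end
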